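import Summits.BirchSwinnertonDyer.BirchSwinnertonDyer.Theorems.ResidualThetaTransportAtTwoLambdaLowerBoundODual
import Summits.BirchSwinnertonDyer.BirchSwinnertonDyer.Theorems.ResidualThetaTransportAtTwoPollackPairKUnique
import Literature.Algebra.Module.CharacterModuleCoNakayama
import HarnessLib

/-!
# «μ = 0 for free» at the level of the ENTRY POINT: on the finite branch the Pontryagin dual of a scalar-stable subgroup
# `Sg ≤ H¹(K_∞, A)` is finitely generated over `𝒪` (hence over `Λ_𝒪`) — co-Nakayama for `Sg⋆ = Hom(Sg, ℚ/ℤ)`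

Route `ResidualThetaTransportAtTwo` (RTT), crux RSL_g `ResidualSignedLambdaLowerCMAtTwo` (stmt-BirchSwinnertonDyer-22608; the
(R≥)ᵖ crux stmt-BirchSwinnertonDyer-26074 is glue above it). Seat `prover-bsd-wall-rtt-p2` g16 (`--supports`, closes nothing).
THEOREMS ONLY (no definition, no named fact, no instance, no `sorry`); BSD is not proved by any of this; 22608 / 26074 OPEN.

WHY. The entry point `LambdaLowerBoundO.cmLambdaLower_of_corank_of_finite` (p660988) and the Pontryagin brick
`pow_le_encard_of_dualPair_of_subset` (w2) DEMAND `Module.Finite (IwasawaAlgebraO S) X` for the dual `X` of the scalar-stable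
Selmer subgroup `Sg` (and derive `𝒪`-finiteness from the finiteness of `Sg[ϖ]`); nothing in the tree supplied that binder. On the
finite branch it is FREE: `Sg ≤ H¹(Gal(K̄/K_∞), A)`, `A = Fⁿ/𝒪ⁿ` (`F = ℚ_p(S)`, `𝒪 = padicCoeffIntegers S`), is `p`-power torsion
(compact group, discrete `p`-primary module: tree `exists_pow_smul_subgroupH1_eq_zero`, `exists_pow_smul_cofree_eq_zero`), `𝒪` is
`ϖ`-adically complete, so the tree's co-Nakayama lemma `Literature.Algebra.Module.CharacterModule.module_finite_of_finite_torsionBySet`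
(Greenberg 2006 Prop. 3.2 / Lang Ch. 5 §1) gives: `Sg[ϖ]` finite ⇒ `Sg⋆` finitely generated over `𝒪`.

* §1 `𝒪 = padicCoeffIntegers S` bookkeeping (stated on the crux's own carrier, no `unitBall` in the statements):
  `not_isUnit_natCast_prime_padicCoeffIntegers`, `isPrecomplete_span_natCast_prime_padicCoeffIntegers`,
  `exists_span_pow_le_span_natCast_prime` (`(ϖ)^e ⊆ (p) ⊆ (ϖ)`, `e ≥ 1`), `isPrecomplete_span_of_irreducible`.
* §2 **`module_finite_characterModule_of_finite_scalarH1_torsion`** — for `Sg ≤ H¹(κ.kerSubgroup, Cofree ρ F)` carrying ANY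
  `𝒪`-module structure whose scalars are the tree's `scalarH1` (the convention of `exists_dualPair_of_stable` / EPW §3.1) and a
  uniformiser `ϖ` with `{c ∈ Sg | scalarH1 ϖ c = 0}` finite: `Module.Finite 𝒪 (CharacterModule Sg)`; and
  **`module_finite_characterModule_of_finite_scalarH1_torsion_of_isScalarTower`** — hence `Module.Finite Λ` for every compatible
  `Λ`-structure (`Λ ⊇ 𝒪` any algebra in a scalar tower, e.g. `IwasawaAlgebraO S` with `T = conj_γ − 1`).

References: [Greenberg2006] §3 A (proof of Prop. 3.2); [GreenbergLNM1716] §1 (PDF p. 60); [EmertonPollackWeston2006] §3.1;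
[NeukirchANT1999] Ch. II (4.8).
-/

set_option autoImplicit false
-- the Theorems namespace of this sub repeats the summit name by design (D-0017 nested layout)
set_option linter.dupNamespace false

noncomputable section

open scoped Classical

namespace Summit.BirchSwinnertonDyer.BirchSwinnertonDyer.Theorems.LambdaLowerBoundO

open Literature.NumberTheory.EllipticCurves Literature.NumberTheory.EllipticCurves.GreenbergSelmer
open Literature.NumberTheory.GaloisRepresentations NumberField IsDedekindDomain Field
open Literature.Algebra.Module

/-! ### §1. `𝒪 = padicCoeffIntegers S`: `p` is a non-unit, `(p)`-adic precompleteness, `(ϖ)^e ⊆ (p) ⊆ (ϖ)` -/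

section Integers

variable {p : ℕ} [Fact p.Prime] (S : Set (PadicAlgCl p)) [FiniteDimensional ℚ_[p] (padicCoeffField S)]

omit [FiniteDimensional ℚ_[p] (padicCoeffField S)] in
/-- `p` is not a unit of `𝒪 = padicCoeffIntegers S` (`‖p‖ < 1`; transported from the unit ball of `ℚ_p(S)`).
[cite: NeukirchANT1999, Ch. II (4.8)] -/
theorem not_isUnit_natCast_prime_padicCoeffIntegers : ¬ IsUnit ((p : ℕ) : padicCoeffIntegers S) := by
  rw [padicCoeffIntegers_eq_unitBall S]
  exact Literature.NumberTheory.Automorphic.PadicIntermediateField.not_isUnit_natCast_prime p _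

/-- `𝒪 = padicCoeffIntegers S` is `(p)`-adically precomplete (`𝒪` is finite free over `ℤ_p`; transported from the unit ball).
[cite: NeukirchANT1999, Ch. II (4.8)] -/
theorem isPrecomplete_span_natCast_prime_padicCoeffIntegers :
    IsPrecomplete (Ideal.span {((p : ℕ) : padicCoeffIntegers S)}) (padicCoeffIntegers S) := by
  rw [padicCoeffIntegers_eq_unitBall S]
  exact isPrecomplete_span_prime_unitBall p _

/-- For a uniformiser `ϖ` of the DVR `𝒪`: `(ϖ)^e ⊆ (p) ⊆ (ϖ)` for some `e ≥ 1` (`p = u·ϖ^e`, `p` a non-unit).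
[cite: NeukirchANT1999, Ch. II (4.8)] -/
theorem exists_span_pow_le_span_natCast_prime {ϖ : padicCoeffIntegers S} (hϖ : Irreducible ϖ) :
    ∃ e : ℕ, 0 < e ∧ Ideal.span {ϖ} ^ e ≤ Ideal.span {((p : ℕ) : padicCoeffIntegers S)} ∧
      Ideal.span {((p : ℕ) : padicCoeffIntegers S)} ≤ Ideal.span {ϖ} := by
  haveI : IsDiscreteValuationRing (padicCoeffIntegers S) := PollackPairK.isDiscreteValuationRing_padicCoeffIntegers (S := S)
  have hp0 : ((p : ℕ) : padicCoeffIntegers S) ≠ 0 := by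
    simpa using PollackPairK.natCast_pow_ne_zero_padicCoeffIntegers (p := p) (S := S) 1
  obtain ⟨e, u, hpe⟩ := IsDiscreteValuationRing.eq_unit_mul_pow_irreducible hp0 hϖ
  have he : 0 < e := by
    rcases Nat.eq_zero_or_pos e with h0 | h0
    · exact absurd (by rw [hpe, h0, pow_zero, mul_one]; exact u.isUnit) (not_isUnit_natCast_prime_padicCoeffIntegers S)
    · exact h0
  refine ⟨e, he, ?_, ?_⟩
  · rw [Ideal.span_singleton_pow, Ideal.span_singleton_le_iff_mem, Ideal.mem_span_singleton']
    exact ⟨↑u⁻¹, by rw [hpe, ← mul_assoc, Units.inv_mul, one_mul]⟩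
  · rw [Ideal.span_singleton_le_iff_mem, Ideal.mem_span_singleton']
    exact ⟨↑u * ϖ ^ (e - 1), by
      rw [hpe, mul_assoc, ← pow_succ, Nat.sub_add_cancel he]⟩

/-- **`𝒪` is `(ϖ)`-adically precomplete** for every uniformiser `ϖ` (the `(p)`- and `(ϖ)`-adic topologies agree).
[cite: NeukirchANT1999, Ch. II (4.8)] -/
theorem isPrecomplete_span_of_irreducible {ϖ : padicCoeffIntegers S} (hϖ : Irreducible ϖ) :
    IsPrecomplete (Ideal.span {ϖ}) (padicCoeffIntegers S) := by
  haveI := isPrecomplete_span_natCast_prime_padicCoeffIntegers S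
  obtain ⟨e, he, hpow, hle⟩ := exists_span_pow_le_span_natCast_prime S hϖ
  exact isPrecomplete_of_pow_le he hpow hle

end Integers

/-! ### §2. Co-Nakayama for the dual of a scalar-stable subgroup of `H¹(K_∞, A)` -/

section Dual

variable {p : ℕ} [Fact p.Prime] {K : Type} [Field K] [NumberField K] (S : Set (PadicAlgCl p))
  [FiniteDimensional ℚ_[p] (padicCoeffField S)] {n : ℕ}
  (κ : ZpExtension K p) (ρ : FramedGaloisRep K (padicCoeffIntegers S) n)
  (Sg : AddSubgroup (subgroupH1 κ.kerSubgroup (Cofree ρ (padicCoeffField S))))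

/-- **On the finite branch the Selmer dual is finitely generated over `𝒪` («μ = 0 for free»).** For an additive subgroup
`Sg ≤ H¹(Gal(K̄/K_∞), A)`, `A = Fⁿ/𝒪ⁿ`, carrying an `𝒪`-module structure whose scalars ARE the tree's `scalarH1` (the convention
of `exists_dualPair_of_stable`), and a uniformiser `ϖ` with `{c ∈ Sg | scalarH1 ϖ c = 0}` finite: the Pontryagin dual
`Sg⋆ = CharacterModule Sg` is a finitely generated `𝒪`-module. Proof: every class is killed by a power of `p`
(`exists_pow_smul_subgroupH1_eq_zero` + `exists_pow_smul_cofree_eq_zero`), hence by a power of `(ϖ)`; `𝒪` is `(ϖ)`-precomplete;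
`Sg[(ϖ)] = Sg[ϖ]` is finite; co-Nakayama `CharacterModule.module_finite_of_finite_torsionBySet`.
[cite: Greenberg2006, §3 A (proof of Prop. 3.2, p. 359 L9–11)] [cite: GreenbergLNM1716, §1 (after Conj. 1.3)]
[cite: EmertonPollackWeston2006, §3.1 (arXiv:math/0404484 p. 17)] -/
theorem module_finite_characterModule_of_finite_scalarH1_torsion [inst : Module (padicCoeffIntegers S) Sg]
    (hsmul : ∀ (a : padicCoeffIntegers S) (s : Sg),
      ((a • s : Sg) : subgroupH1 κ.kerSubgroup (Cofree ρ (padicCoeffField S))) =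
        scalarH1 κ.kerSubgroup (Cofree ρ (padicCoeffField S)) a s)
    {ϖ : padicCoeffIntegers S} (hϖ : Irreducible ϖ)
    (hfin : {c : subgroupH1 κ.kerSubgroup (Cofree ρ (padicCoeffField S)) |
      c ∈ Sg ∧ scalarH1 κ.kerSubgroup (Cofree ρ (padicCoeffField S)) ϖ c = 0}.Finite) :
    Module.Finite (padicCoeffIntegers S) (CharacterModule Sg) := by
  haveI := isPrecomplete_span_of_irreducible S hϖ
  obtain ⟨e, he, hpow, -⟩ := exists_span_pow_le_span_natCast_prime S hϖ
  -- every class is killed by a power of `(ϖ)`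
  have htors : ∀ s : Sg, ∃ k : ℕ, ∀ r ∈ Ideal.span {ϖ} ^ k, r • s = 0 := by
    intro s
    obtain ⟨N, hN⟩ := exists_pow_smul_subgroupH1_eq_zero κ (Cofree ρ (padicCoeffField S))
      (exists_pow_smul_cofree_eq_zero S ρ) (s : subgroupH1 κ.kerSubgroup (Cofree ρ (padicCoeffField S)))
    have hpN : ((p : ℕ) : padicCoeffIntegers S) ^ N • s = 0 := by
      apply Subtype.ext
      rw [← Nat.cast_pow, Nat.cast_smul_eq_nsmul, AddSubgroupClass.coe_nsmul, hN, ZeroMemClass.coe_zero]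
    refine ⟨e * N, fun r hr ↦ ?_⟩
    have hr' : r ∈ Ideal.span {((p : ℕ) : padicCoeffIntegers S) ^ N} := by
      rw [← Ideal.span_singleton_pow]
      exact Ideal.pow_right_mono hpow N (by rwa [← pow_mul])
    obtain ⟨t, rfl⟩ := Ideal.mem_span_singleton'.mp hr'
    rw [mul_smul, hpN, smul_zero]
  -- `Sg[(ϖ)] ↪ {c ∈ Sg | scalarH1 ϖ c = 0}` is finite
  haveI : Finite (Submodule.torsionBySet (padicCoeffIntegers S) Sg (Ideal.span {ϖ} : Set (padicCoeffIntegers S))) := by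
    rw [Submodule.torsionBySet_span_singleton_eq]
    haveI := hfin.to_subtype
    refine Finite.of_injective
      (fun s : Submodule.torsionBy (padicCoeffIntegers S) Sg ϖ ↦
        (⟨((s : Sg) : subgroupH1 κ.kerSubgroup (Cofree ρ (padicCoeffField S))), (s : Sg).2, ?_⟩ :
          {c : subgroupH1 κ.kerSubgroup (Cofree ρ (padicCoeffField S)) |
            c ∈ Sg ∧ scalarH1 κ.kerSubgroup (Cofree ρ (padicCoeffField S)) ϖ c = 0}))
      (fun s t hst ↦ Subtype.ext (Subtype.ext (by have h := congrArg Subtype.val hst; dsimp only at h; exact h)))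
    rw [← hsmul, (Submodule.mem_torsionBy_iff ϖ (s : Sg)).mp s.2, ZeroMemClass.coe_zero]
  exact CharacterModule.module_finite_of_finite_torsionBySet (Ideal.span {ϖ}) ⟨{ϖ}, by simp⟩ htors

/-- **… hence finitely generated over every compatible `Λ ⊇ 𝒪`** (e.g. `Λ = IwasawaAlgebraO S = 𝒪⟦T⟧` with `T = conj_γ − 1`, the
structure of `exists_dualPair_of_stable`): the binder `Module.Finite (IwasawaAlgebraO S) X` of `cmLambdaLower_of_corank_of_finite`
and `pow_le_encard_of_dualPair_of_subset` is FREE on the finite branch.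
[cite: Greenberg2006, §3 A (proof of Prop. 3.2)] [cite: EmertonPollackWeston2006, §3.1] -/
theorem module_finite_characterModule_of_finite_scalarH1_torsion_of_isScalarTower
    [inst : Module (padicCoeffIntegers S) Sg]
    (hsmul : ∀ (a : padicCoeffIntegers S) (s : Sg),
      ((a • s : Sg) : subgroupH1 κ.kerSubgroup (Cofree ρ (padicCoeffField S))) =
        scalarH1 κ.kerSubgroup (Cofree ρ (padicCoeffField S)) a s)
    {ϖ : padicCoeffIntegers S} (hϖ : Irreducible ϖ)
    (hfin : {c : subgroupH1 κ.kerSubgroup (Cofree ρ (padicCoeffField S)) |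
      c ∈ Sg ∧ scalarH1 κ.kerSubgroup (Cofree ρ (padicCoeffField S)) ϖ c = 0}.Finite)
    (Λ : Type) [Ring Λ] [Algebra (padicCoeffIntegers S) Λ] [instΛ : Module Λ (CharacterModule Sg)]
    [IsScalarTower (padicCoeffIntegers S) Λ (CharacterModule Sg)] :
    Module.Finite Λ (CharacterModule Sg) := by
  haveI := module_finite_characterModule_of_finite_scalarH1_torsion S κ ρ Sg hsmul hϖ hfin
  exact Module.Finite.of_restrictScalars_finite (padicCoeffIntegers S) Λ (CharacterModule Sg)

end Dual

end Summit.BirchSwinnertonDyer.BirchSwinnertonDyer.Theorems.LambdaLowerBoundO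

end
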